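import Literature.MathematicalPhysics.QuantumLattice.GrassmannCumulantPolarisedGradedPrescribedDB
import HarnessLib

/-!
# The GRADED truncated step with PRESCRIBED output legs is LIPSCHITZ in the interaction, in TELESCOPED form
# (determinant-bounded covariances; the levels track)

Topic `MathematicalPhysics/QuantumLattice`; the label-restricted twin of `GrassmannEffectiveActionGradedLipschitzDB` (plain pinned norms) on the
LEVELS track of `GrassmannEffectiveActionGradedTruncationPrescribedDB`: one output label pinned, the output labels of the slots `j ∈ J` constrained to
prescribed predicates `A j`, the others summed; the kernels of the two interactions enter through the two-parameter families `μ(m', F)` (a COMMON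
majorant of `V`, `V′`) and `ν(m', F)` (the difference `V − V′`) of anchored `L¹` norms with `F` further legs constrained.  Assembled from the polarised
prescribed cumulant bound `GrassmannCumulantPolarisedGradedPrescribedDB.sum_norm_kernel_cumulantOf_sub_le_graded_prescribed_of_gramBounded` (orders
`2 … N₀−1`, telescoped: one slot carries `ν`, the others `μ`, averaged over the landing profiles) and the flat tails of
`sum_norm_kernel_effAction_add_sum_cumulant_le_of_gramBounded` (orders `≥ N₀`, both interactions at the common majorant; the constrained sum is part of
the free one).  Benfatto–Giuliani–Mastropietro 2006, (2.13)–(2.14), (2.77)–(2.80), §2.4 Lemma 2.6, (2.87)–(2.90); Gawȩdzki–Kupiainen 1985, §3: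

* **`sum_norm_kernel_effAction_sub_gaussConv_sub_le_graded_prescribed_of_gramBounded`** — with `‖μ‖_h = Σ_{m' ≤ |Γ|/2} (e²(κ+ρ))^{2m'} μ(m', 0)`,
  `θ = eα‖μ‖_h/κ² < 1`, for every `N₀ ≥ 2` and every degree `m ≥ 1`,
  `Σ_{W : W_i = w, A_j(W_j)} ‖kernel_m ((effAction C V − e^{Δ_C}V) − (effAction C V′ − e^{Δ_C}V′))(W)‖ ≤
     Σ_{n=2}^{N₀−1} κ^{-m}κ^{-2(n−1)}α^{n−1}eⁿ · Σ_{δ ∈ [0,|Γ|/2]^n, m + 2(n−1) ≤ Σ 2δ_a} Σ_φ w_φ Σ_a (e³κ)^{2δ_a} ν(δ_a, |φ⁻¹ a|)·Π_{b ≠ a} (e³κ)^{2δ_b} μ(δ_b, |φ⁻¹ b|)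
     + 2·ρ^{-m} e‖μ‖_h θ^{N₀−1}/(1−θ)`.

The Grassmann supplier, on the levels track, of the Lipschitz (two-volume / two-cutoff difference) blocked tower of the cell gate-hubbard-kl (K3 engine
child stmt-…-20437, stub (e) rows C1/C2 «(e)-C ⇐ (b)-TWOVOL»; E1 lead's word 2026-08-27: the difference tower closes in the recursive degrees with the same
majorants as the one-volume LEVELS tower).  Everything is proved; no definition, no named fact.

## Sources

G. Benfatto, A. Giuliani, V. Mastropietro, Ann. Henri Poincaré 7 (2006) 809–898, (2.13)–(2.14), (2.77)–(2.80), §2.4 Lemma 2.6, (2.87)–(2.90)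
[`BenfattoGiulianiMastropietro2006`]; K. Gawȩdzki, A. Kupiainen, Comm. Math. Phys. 102 (1985) 1–30, §3 [`GawedzkiKupiainen1985GrossNeveu`].
-/

noncomputable section

namespace Literature.MathematicalPhysics.QuantumLattice

open GrassmannAlgebra Finset Literature.Probability.LatticeModels
open scoped InnerProductSpace Nat

universe u

section GradedLipschitzPrescribed

variable {𝕜 : Type*} [RCLike 𝕜] {Γ : Type u} [Fintype Γ] [DecidableEq Γ] (C : Matrix Γ Γ 𝕜)

omit [Fintype Γ] [DecidableEq Γ] in
/-- Kernels of a difference. [folklore] -/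
private theorem kernel_sub_eq'' (A B : GrassmannAlgebra 𝕜 Γ) (m : ℕ) (X : Fin m → Γ) :
    kernel 𝕜 (A - B) m X = kernel 𝕜 A m X - kernel 𝕜 B m X := by
  rw [sub_eq_add_neg, kernel_add, ← neg_one_smul 𝕜 B, kernel_smul, neg_one_mul, ← sub_eq_add_neg]

/-- **THE GRADED TRUNCATED STEP WITH PRESCRIBED LEGS IS LIPSCHITZ IN THE INTERACTION, TELESCOPED** (BGM 2006 (2.13)–(2.14), (2.77)–(2.80), Lemma 2.6,
(2.87)–(2.90); Gawȩdzki–Kupiainen 1985 §3; the polarised twin of `sum_norm_kernel_effAction_sub_gaussConv_le_graded_prescribed_of_gramBounded`):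
charged covariance replica-Gram-bounded with constant `κ`, row/column sums `≤ α`, output weight `ρ`; two even interactions `V`, `V′` without constant
part whose kernels have anchored `L¹` norms with `F` further legs constrained to the prescribed predicates at most a COMMON majorant `μ(m', F)`, the
difference `kernel V − kernel V′` at most `ν(m', F)`; `θ = eα‖μ‖_h/κ² < 1` with `‖μ‖_h = Σ_{m'} (e²(κ+ρ))^{2m'} μ(m', 0)`.  Then for every `N₀ ≥ 2` and
every degree `m ≥ 1`, one output label pinned, the slots `j ∈ J` constrained and the others summed,
`Σ_W ‖kernel_m ((effAction C V − e^{Δ_C}V) − (effAction C V′ − e^{Δ_C}V′))(W)‖ ≤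
   Σ_{n=2}^{N₀−1} κ^{-m}κ^{-2(n−1)}α^{n−1}eⁿ · Σ_{δ : m + 2(n−1) ≤ Σ 2δ_a} Σ_φ w_φ Σ_a (e³κ)^{2δ_a} ν(δ_a, |φ⁻¹ a|)·Π_{b ≠ a} (e³κ)^{2δ_b} μ(δ_b, |φ⁻¹ b|)
   + 2·ρ^{-m} e‖μ‖_h θ^{N₀−1}/(1−θ)`. [cite: BenfattoGiulianiMastropietro2006, (2.13)-(2.14), (2.77)-(2.80) and Lemma 2.6] -/
theorem sum_norm_kernel_effAction_sub_gaussConv_sub_le_graded_prescribed_of_gramBounded {κ : ℝ} (hκ : 0 < κ) (hGB : IsGramBoundedR C κ)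
    (V V' : GrassmannAlgebra 𝕜 Γ) (hV : V ∈ evenPart 𝕜 Γ) (hV' : V' ∈ evenPart 𝕜 Γ) (hV0 : constPart 𝕜 V = 0)
    (hV'0 : constPart 𝕜 V' = 0) {m : ℕ} (J : Finset (Fin m)) (A : Fin m → Γ → Bool)
    (μ ν : ℕ → ℕ → ℝ) (hμ0 : ∀ m' F, 0 ≤ μ m' F) (hν0 : ∀ m' F, 0 ≤ ν m' F)
    (hμ : ∀ (m' : ℕ) (T : Finset (Fin m)), T ⊆ J → ∀ (ι : T → Fin (2 * m')), Function.Injective ι →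
      ∀ (t : Fin (2 * m')), (∀ j, ι j ≠ t) → ∀ a : Γ,
        ∑ Y ∈ univ.filter (fun Y : Fin (2 * m') → Γ => Y t = a),
          ‖kernel 𝕜 V (2 * m') Y‖ * ∏ j : T, (if A j (Y (ι j)) = true then (1 : ℝ) else 0) ≤ μ m' T.card)
    (hμ' : ∀ (m' : ℕ) (T : Finset (Fin m)), T ⊆ J → ∀ (ι : T → Fin (2 * m')), Function.Injective ι →
      ∀ (t : Fin (2 * m')), (∀ j, ι j ≠ t) → ∀ a : Γ,
        ∑ Y ∈ univ.filter (fun Y : Fin (2 * m') → Γ => Y t = a),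
          ‖kernel 𝕜 V' (2 * m') Y‖ * ∏ j : T, (if A j (Y (ι j)) = true then (1 : ℝ) else 0) ≤ μ m' T.card)
    (hν : ∀ (m' : ℕ) (T : Finset (Fin m)), T ⊆ J → ∀ (ι : T → Fin (2 * m')), Function.Injective ι →
      ∀ (t : Fin (2 * m')), (∀ j, ι j ≠ t) → ∀ a : Γ,
        ∑ Y ∈ univ.filter (fun Y : Fin (2 * m') → Γ => Y t = a),
          ‖kernel 𝕜 V (2 * m') Y - kernel 𝕜 V' (2 * m') Y‖ * ∏ j : T, (if A j (Y (ι j)) = true then (1 : ℝ) else 0) ≤ ν m' T.card)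
    {α : ℝ} (hα : 0 < α) (hrow : ∀ X, ∑ Y, ‖C X Y‖ ≤ α) (hcol : ∀ Y, ∑ X, ‖C X Y‖ ≤ α) {ρ : ℝ} (hρ : 0 < ρ)
    (hθ : Real.exp 1 * α * normV Γ κ ρ (fun m' => μ m' 0) / κ ^ 2 < 1) {N₀ : ℕ} (hN₀ : 2 ≤ N₀) (hm : 0 < m) (i : Fin m) (hi : i ∉ J)
    (w : Γ) :
    ∑ W ∈ univ.filter (fun W : Fin m → Γ => W i = w ∧ ∀ j ∈ J, A j (W j) = true),
        ‖kernel 𝕜 ((effAction 𝕜 C V - gaussConv 𝕜 C V) - (effAction 𝕜 C V' - gaussConv 𝕜 C V')) m W‖ ≤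
      ∑ n ∈ Ico 2 N₀, (κ⁻¹ ^ m * κ⁻¹ ^ (2 * (n - 1)) * (α ^ (n - 1) * Real.exp n)) *
          ∑ δ ∈ (Fintype.piFinset fun _ : Fin n => range (Fintype.card Γ / 2 + 1)) with m + 2 * (n - 1) ≤ ∑ a, 2 * δ a,
            ∑ pf : J → Fin n, ((∏ j, ((2 * δ (pf j) : ℕ) : ℝ)) / ((∑ a, 2 * δ a : ℕ) : ℝ) ^ J.card) *
              ∑ a, (Real.exp 3 * κ) ^ (2 * δ a) * ν (δ a) (univ.filter fun j : J => pf j = a).card *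
                ∏ b ∈ univ.erase a, (Real.exp 3 * κ) ^ (2 * δ b) * μ (δ b) (univ.filter fun j : J => pf j = b).card +
        2 * (ρ⁻¹ ^ m * (Real.exp 1 * normV Γ κ ρ (fun m' => μ m' 0)) *
          (Real.exp 1 * α * normV Γ κ ρ (fun m' => μ m' 0) / κ ^ 2) ^ (N₀ - 1) /
            (1 - Real.exp 1 * α * normV Γ κ ρ (fun m' => μ m' 0) / κ ^ 2)) := by
  -- notation (as in `sum_norm_kernel_effAction_sub_gaussConv_le_graded_prescribed_of_gramBounded`)
  set X : evenPart 𝕜 Γ := ⟨-V, neg_mem hV⟩ with hX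
  set X' : evenPart 𝕜 Γ := ⟨-V', neg_mem hV'⟩ with hX'
  set degs : Finset ℕ := range (Fintype.card Γ / 2 + 1) with hdegs
  set K : (m' : ℕ) → (Fin (2 * m') → Γ) → 𝕜 := fun m' => kernel 𝕜 (-V) (2 * m') with hK
  set K' : (m' : ℕ) → (Fin (2 * m') → Γ) → 𝕜 := fun m' => kernel 𝕜 (-V') (2 * m') with hK'
  set Wset := univ.filter (fun W : Fin m → Γ => W i = w ∧ ∀ j ∈ J, A j (W j) = true) with hWset
  have hXv : vertexOf 𝕜 degs K = X := Subtype.ext (coe_vertexOf_kernel_eq 𝕜 X)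
  have hXv' : vertexOf 𝕜 degs K' = X' := Subtype.ext (coe_vertexOf_kernel_eq 𝕜 X')
  have hKneg : ∀ (B : GrassmannAlgebra 𝕜 Γ) (m' : ℕ) (Y : Fin (2 * m') → Γ), kernel 𝕜 (-B) (2 * m') Y = -kernel 𝕜 B (2 * m') Y := by
    intro B m' Y
    rw [show -B = (-1 : 𝕜) • B from (neg_one_smul 𝕜 B).symm, kernel_smul, neg_one_mul]
  -- the constrained hypotheses for the kernels of `-V`, `-V′` and of their difference
  have hKb : ∀ (m' : ℕ) (T : Finset (Fin m)), T ⊆ J → ∀ (ι : T → Fin (2 * m')), Function.Injective ι →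
      ∀ (t : Fin (2 * m')), (∀ j, ι j ≠ t) → ∀ a : Γ,
        ∑ Y ∈ univ.filter (fun Y : Fin (2 * m') → Γ => Y t = a),
          ‖K m' Y‖ * ∏ j : T, (if A j (Y (ι j)) = true then (1 : ℝ) else 0) ≤ μ m' T.card := by
    intro m' T hT ι hι t ht a
    simp only [hK, hKneg, norm_neg]
    exact hμ m' T hT ι hι t ht a
  have hKb' : ∀ (m' : ℕ) (T : Finset (Fin m)), T ⊆ J → ∀ (ι : T → Fin (2 * m')), Function.Injective ι →
      ∀ (t : Fin (2 * m')), (∀ j, ι j ≠ t) → ∀ a : Γ,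
        ∑ Y ∈ univ.filter (fun Y : Fin (2 * m') → Γ => Y t = a),
          ‖K' m' Y‖ * ∏ j : T, (if A j (Y (ι j)) = true then (1 : ℝ) else 0) ≤ μ m' T.card := by
    intro m' T hT ι hι t ht a
    simp only [hK', hKneg, norm_neg]
    exact hμ' m' T hT ι hι t ht a
  have hDb : ∀ (m' : ℕ) (T : Finset (Fin m)), T ⊆ J → ∀ (ι : T → Fin (2 * m')), Function.Injective ι →
      ∀ (t : Fin (2 * m')), (∀ j, ι j ≠ t) → ∀ a : Γ,
        ∑ Y ∈ univ.filter (fun Y : Fin (2 * m') → Γ => Y t = a),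
          ‖K m' Y - K' m' Y‖ * ∏ j : T, (if A j (Y (ι j)) = true then (1 : ℝ) else 0) ≤ ν m' T.card := by
    intro m' T hT ι hι t ht a
    simp only [hK, hK', hKneg, ← neg_sub', norm_neg]
    simpa only [neg_sub] using hν m' T hT ι hι t ht a
  -- the plain anchored norms (`T = ∅`) for the flat tails
  have hμplain : ∀ (B : GrassmannAlgebra 𝕜 Γ),
      (∀ (m' : ℕ) (T : Finset (Fin m)), T ⊆ J → ∀ (ι : T → Fin (2 * m')), Function.Injective ι →
        ∀ (t : Fin (2 * m')), (∀ j, ι j ≠ t) → ∀ a : Γ,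
          ∑ Y ∈ univ.filter (fun Y : Fin (2 * m') → Γ => Y t = a),
            ‖kernel 𝕜 B (2 * m') Y‖ * ∏ j : T, (if A j (Y (ι j)) = true then (1 : ℝ) else 0) ≤ μ m' T.card) →
      ∀ (m' : ℕ) (j : Fin (2 * m')) (w' : Γ),
        ∑ Y ∈ univ.filter (fun Y : Fin (2 * m') → Γ => Y j = w'), ‖kernel 𝕜 B (2 * m') Y‖ ≤ μ m' 0 := by
    intro B hB m' j w'
    have h := hB m' ∅ (empty_subset _) (fun j => (notMem_empty _ j.2).elim) (fun j => (notMem_empty _ j.2).elim) j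
      (fun j => (notMem_empty _ j.2).elim) w'
    simpa using h
  set κs : ℕ → evenPart 𝕜 Γ := fun n => cumulantOf (fun k => evenGaussConv 𝕜 C (X ^ k)) n with hκs
  set κs' : ℕ → evenPart 𝕜 Γ := fun n => cumulantOf (fun k => evenGaussConv 𝕜 C (X' ^ k)) n with hκs'
  have hκs_eq : ∀ n, κs n = cumulantOf (fun k => evenGaussConv 𝕜 C (vertexOf 𝕜 degs K ^ k)) n := fun n => by rw [hXv]
  have hκs'_eq : ∀ n, κs' n = cumulantOf (fun k => evenGaussConv 𝕜 C (vertexOf 𝕜 degs K' ^ k)) n := fun n => by rw [hXv']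
  -- the flat tails at order `N₀`, both at the common majorant (the constrained sum is part of the free one)
  obtain ⟨-, hbd⟩ := sum_norm_kernel_effAction_add_sum_cumulant_le_of_gramBounded C hκ hGB V hV hV0 (fun m' => μ m' 0)
    (fun m' => hμ0 m' 0) (hμplain V hμ) hα hrow hcol hρ hθ (n₀ := N₀) (by omega)
  obtain ⟨-, hbd'⟩ := sum_norm_kernel_effAction_add_sum_cumulant_le_of_gramBounded C hκ hGB V' hV' hV'0 (fun m' => μ m' 0)
    (fun m' => hμ0 m' 0) (hμplain V' hμ') hα hrow hcol hρ hθ (n₀ := N₀) (by omega)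
  set tail : ℝ := ρ⁻¹ ^ m * (Real.exp 1 * normV Γ κ ρ (fun m' => μ m' 0)) *
    (Real.exp 1 * α * normV Γ κ ρ (fun m' => μ m' 0) / κ ^ 2) ^ (N₀ - 1) /
      (1 - Real.exp 1 * α * normV Γ κ ρ (fun m' => μ m' 0) / κ ^ 2) with htaildef
  have hsub : Wset ⊆ univ.filter (fun W : Fin m → Γ => W i = w) := by
    intro W hW
    rw [hWset, mem_filter] at hW
    exact mem_filter.2 ⟨hW.1, hW.2.1⟩
  have htail : ∑ W ∈ Wset, ‖kernel 𝕜 (effAction 𝕜 C V) m W + ∑ n ∈ Ico 1 N₀, ((n ! : 𝕜))⁻¹ *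
      kernel 𝕜 ((κs n : evenPart 𝕜 Γ) : GrassmannAlgebra 𝕜 Γ) m W‖ ≤ tail :=
    le_trans (sum_le_sum_of_subset_of_nonneg hsub fun _ _ _ => norm_nonneg _) (hbd hm i w)
  have htail' : ∑ W ∈ Wset, ‖kernel 𝕜 (effAction 𝕜 C V') m W + ∑ n ∈ Ico 1 N₀, ((n ! : 𝕜))⁻¹ *
      kernel 𝕜 ((κs' n : evenPart 𝕜 Γ) : GrassmannAlgebra 𝕜 Γ) m W‖ ≤ tail :=
    le_trans (sum_le_sum_of_subset_of_nonneg hsub fun _ _ _ => norm_nonneg _) (hbd' hm i w)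
  -- the polarised graded bound of one cumulant term, with the `1/n!`
  set G : ℕ → ℝ := fun n => (κ⁻¹ ^ m * κ⁻¹ ^ (2 * (n - 1)) * (α ^ (n - 1) * Real.exp n)) *
      ∑ δ ∈ (Fintype.piFinset fun _ : Fin n => degs) with m + 2 * (n - 1) ≤ ∑ a, 2 * δ a,
        ∑ pf : J → Fin n, ((∏ j, ((2 * δ (pf j) : ℕ) : ℝ)) / ((∑ a, 2 * δ a : ℕ) : ℝ) ^ J.card) *
          ∑ a, (Real.exp 3 * κ) ^ (2 * δ a) * ν (δ a) (univ.filter fun j : J => pf j = a).card *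
            ∏ b ∈ univ.erase a, (Real.exp 3 * κ) ^ (2 * δ b) * μ (δ b) (univ.filter fun j : J => pf j = b).card with hG
  have hterm : ∀ n, 0 < n → ∑ W ∈ Wset,
      ‖((n ! : 𝕜))⁻¹ * kernel 𝕜 ((κs n : evenPart 𝕜 Γ) : GrassmannAlgebra 𝕜 Γ) m W -
        ((n ! : 𝕜))⁻¹ * kernel 𝕜 ((κs' n : evenPart 𝕜 Γ) : GrassmannAlgebra 𝕜 Γ) m W‖ ≤ G n := by
    intro n hn
    have h := sum_norm_kernel_cumulantOf_sub_le_graded_prescribed_of_gramBounded C hκ hGB degs K K' J A μ ν hμ0 hν0 hKb hKb' hDb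
      hα hrow hcol hn i hi w
    rw [← hκs_eq, ← hκs'_eq] at h
    have hfac : (0 : ℝ) < n ! := by positivity
    calc ∑ W ∈ Wset, ‖((n ! : 𝕜))⁻¹ * kernel 𝕜 ((κs n : evenPart 𝕜 Γ) : GrassmannAlgebra 𝕜 Γ) m W -
            ((n ! : 𝕜))⁻¹ * kernel 𝕜 ((κs' n : evenPart 𝕜 Γ) : GrassmannAlgebra 𝕜 Γ) m W‖
        = (n ! : ℝ)⁻¹ * ∑ W ∈ Wset,
            ‖kernel 𝕜 ((κs n : evenPart 𝕜 Γ) : GrassmannAlgebra 𝕜 Γ) m W - kernel 𝕜 ((κs' n : evenPart 𝕜 Γ) : GrassmannAlgebra 𝕜 Γ) m W‖ := by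
          rw [mul_sum]
          exact sum_congr rfl fun W _ => by rw [← mul_sub, norm_mul, norm_inv, RCLike.norm_natCast]
      _ ≤ (n ! : ℝ)⁻¹ * ((n ! : ℝ) * (κ⁻¹ ^ m * κ⁻¹ ^ (2 * (n - 1)) * (α ^ (n - 1) * Real.exp n)) *
            ∑ δ ∈ (Fintype.piFinset fun _ : Fin n => degs) with m + 2 * (n - 1) ≤ ∑ a, 2 * δ a,
              ∑ pf : J → Fin n, ((∏ j, ((2 * δ (pf j) : ℕ) : ℝ)) / ((∑ a, 2 * δ a : ℕ) : ℝ) ^ J.card) *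
                ∑ a, (Real.exp 3 * κ) ^ (2 * δ a) * ν (δ a) (univ.filter fun j : J => pf j = a).card *
                  ∏ b ∈ univ.erase a, (Real.exp 3 * κ) ^ (2 * δ b) * μ (δ b) (univ.filter fun j : J => pf j = b).card) :=
          mul_le_mul_of_nonneg_left h (by positivity)
      _ = G n := by rw [← mul_assoc, ← mul_assoc, inv_mul_cancel₀ hfac.ne', one_mul]
  -- the algebra (twice `hsplit` of the one-interaction theorem)
  have hone : ∀ (Y : evenPart 𝕜 Γ) (B : GrassmannAlgebra 𝕜 Γ), (Y : GrassmannAlgebra 𝕜 Γ) = -B → ∀ W,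
      ((1 ! : 𝕜))⁻¹ * kernel 𝕜 ((cumulantOf (fun k => evenGaussConv 𝕜 C (Y ^ k)) 1 : evenPart 𝕜 Γ) : GrassmannAlgebra 𝕜 Γ) m W =
        -kernel 𝕜 (gaussConv 𝕜 C B) m W := by
    intro Y B hY W
    rw [Nat.factorial_one, Nat.cast_one, inv_one, one_mul, cumulantOf_one]
    simp only [pow_one, coe_evenGaussConv, hY, map_neg]
    rw [show -gaussConv 𝕜 C B = (-1 : 𝕜) • gaussConv 𝕜 C B from (neg_one_smul 𝕜 _).symm, kernel_smul]
    ring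
  have hsplit : ∀ (Y : evenPart 𝕜 Γ) (B : GrassmannAlgebra 𝕜 Γ), (Y : GrassmannAlgebra 𝕜 Γ) = -B → ∀ W,
      kernel 𝕜 (effAction 𝕜 C B - gaussConv 𝕜 C B) m W =
      (kernel 𝕜 (effAction 𝕜 C B) m W + ∑ n ∈ Ico 1 N₀, ((n ! : 𝕜))⁻¹ *
          kernel 𝕜 ((cumulantOf (fun k => evenGaussConv 𝕜 C (Y ^ k)) n : evenPart 𝕜 Γ) : GrassmannAlgebra 𝕜 Γ) m W) -
        ∑ n ∈ Ico 2 N₀, ((n ! : 𝕜))⁻¹ *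
          kernel 𝕜 ((cumulantOf (fun k => evenGaussConv 𝕜 C (Y ^ k)) n : evenPart 𝕜 Γ) : GrassmannAlgebra 𝕜 Γ) m W := by
    intro Y B hY W
    rw [sum_eq_sum_Ico_succ_bot (by omega : 1 < N₀), hone Y B hY W,
      show effAction 𝕜 C B - gaussConv 𝕜 C B = effAction 𝕜 C B + (-1 : 𝕜) • gaussConv 𝕜 C B by rw [neg_one_smul, sub_eq_add_neg],
      kernel_add, kernel_smul]
    ring
  have hXc : (X : GrassmannAlgebra 𝕜 Γ) = -V := rfl
  have hXc' : (X' : GrassmannAlgebra 𝕜 Γ) = -V' := rfl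
  set T : (Fin m → Γ) → 𝕜 := fun W => kernel 𝕜 (effAction 𝕜 C V) m W + ∑ n ∈ Ico 1 N₀, ((n ! : 𝕜))⁻¹ *
    kernel 𝕜 ((κs n : evenPart 𝕜 Γ) : GrassmannAlgebra 𝕜 Γ) m W with hT
  set T' : (Fin m → Γ) → 𝕜 := fun W => kernel 𝕜 (effAction 𝕜 C V') m W + ∑ n ∈ Ico 1 N₀, ((n ! : 𝕜))⁻¹ *
    kernel 𝕜 ((κs' n : evenPart 𝕜 Γ) : GrassmannAlgebra 𝕜 Γ) m W with hT'
  have hsplitW : ∀ W, kernel 𝕜 ((effAction 𝕜 C V - gaussConv 𝕜 C V) - (effAction 𝕜 C V' - gaussConv 𝕜 C V')) m W =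
      (T W - T' W) - ∑ n ∈ Ico 2 N₀, (((n ! : 𝕜))⁻¹ * kernel 𝕜 ((κs n : evenPart 𝕜 Γ) : GrassmannAlgebra 𝕜 Γ) m W -
        ((n ! : 𝕜))⁻¹ * kernel 𝕜 ((κs' n : evenPart 𝕜 Γ) : GrassmannAlgebra 𝕜 Γ) m W) := by
    intro W
    rw [kernel_sub_eq'', hsplit X V hXc W, hsplit X' V' hXc' W, hT, hT', sum_sub_distrib]
    ring
  -- assemble
  calc ∑ W ∈ Wset, ‖kernel 𝕜 ((effAction 𝕜 C V - gaussConv 𝕜 C V) - (effAction 𝕜 C V' - gaussConv 𝕜 C V')) m W‖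
      ≤ ∑ W ∈ Wset, (‖T W‖ + ‖T' W‖ +
          ∑ n ∈ Ico 2 N₀, ‖((n ! : 𝕜))⁻¹ * kernel 𝕜 ((κs n : evenPart 𝕜 Γ) : GrassmannAlgebra 𝕜 Γ) m W -
            ((n ! : 𝕜))⁻¹ * kernel 𝕜 ((κs' n : evenPart 𝕜 Γ) : GrassmannAlgebra 𝕜 Γ) m W‖) :=
        sum_le_sum fun W _ => by
          rw [hsplitW W]
          exact (norm_sub_le _ _).trans (add_le_add (norm_sub_le _ _) (norm_sum_le _ _))
    _ = ∑ W ∈ Wset, ‖T W‖ + ∑ W ∈ Wset, ‖T' W‖ +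
          ∑ n ∈ Ico 2 N₀, ∑ W ∈ Wset,
            ‖((n ! : 𝕜))⁻¹ * kernel 𝕜 ((κs n : evenPart 𝕜 Γ) : GrassmannAlgebra 𝕜 Γ) m W -
              ((n ! : 𝕜))⁻¹ * kernel 𝕜 ((κs' n : evenPart 𝕜 Γ) : GrassmannAlgebra 𝕜 Γ) m W‖ := by
        rw [sum_add_distrib, sum_add_distrib, sum_comm]
    _ ≤ tail + tail + ∑ n ∈ Ico 2 N₀, G n :=
        add_le_add (add_le_add htail htail') (sum_le_sum fun n hn => hterm n (by have := (mem_Ico.1 hn).1; omega))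
    _ = _ := by rw [hG, htaildef]; ring

end GradedLipschitzPrescribed

end Literature.MathematicalPhysics.QuantumLattice

end
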